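import Literature.AnabelianGeometry.SemiGraphs.TemperedCuspidalAbsolutenessOfCor311
import Literature.AnabelianGeometry.SemiGraphs.TemperedSpecialFibreTower
import HarnessLib

/-!
# [SemiAnbd] Thm. 6.5 (iii) «follows from Corollary 3.11»: the Cor. 3.11 leaf REDUCED to the levelwise
# matching of the special-fibre semi-graphs along `γ` and the pro-cusp reading of the inertia groups

Mochizuki, *Semi-graphs of anabelioids*, Publ. RIMS **42** (2006) [SemiAnbd], §6, Theorem 6.5 (iii), manuscript
p. 72 l. 14: «Assertion (iii) follows from Corollary 3.11» [cite: MochizukiSemiAnbd2006, Thm 6.5(iii) p.72];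
Corollary 3.11, pp. 45–46: «any isomorphism of topological groups `γ : Δ[α] ⥲ Δ[β]` determines a compatible
isomorphism of semi-graphs of anabelioids `𝒢^c[α] ⥲ 𝒢^c[β]` in a fashion that is functorial with respect to
`γ`», its proof, p. 47 (i): «the technique … may also be applied to open subgroups of finite index
`Δ'[α] ⊆ Δ[α]`, `Δ'[β] ⊆ Δ[β]` that correspond via `γ`» [cite: MochizukiSemiAnbd2006, Cor 3.11 pp.45-47];
Example 3.10, p. 44: «an exhaustive sequence of open characteristic subgroups … `N_i` … semi-graphs of
anabelioids `𝒢_i`, `𝒢^c_i` [of the geometric special fibres of the coverings] on which `Δ_i` acts» (the cusps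
being the open edges of `𝒢^c_i`) [cite: MochizukiSemiAnbd2006, Ex 3.10 p.44]; §6 p. 71: «`D_x ⊆ Π^temp_{X_K}`
the decomposition group of `x` … `I_x = D_x ∩ Δ^temp_X`» [cite: MochizukiSemiAnbd2006, §6 p.71].

PROOF-ONLY file (abc-iut cell, L-F pack D [SemiAnbd] §6, seat abc-iut-L3-t11 gen 5, L3-lead β29 row
«G-L3d2g4-1·REDUCE»; no `def`, no `instance`, no new named fact).  abc-iut-L3-d2's
`TemperedOrigin.cuspidalAbsolutenessHolds_of_cor311_of_hatLaw` (`TemperedCuspidalAbsolutenessOfCor311.lean`)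
reduces the row F-1704 `CuspidalAbsolutenessHolds` to F-1708, the profinite `Δ̂`-law and ONE leaf `h311`
(GAP-LEDGER G-L3d2g4-1): «every `γ : Δ^temp_X ⥲ Δ^temp_Y` carries each cuspidal geometric decomposition group
`I_x` onto a `Π^temp_{Y_L}`-conjugate of some `I_y`».  This file DERIVES `h311` from the statements the
printed route «(iii) follows from Corollary 3.11» actually passes through, displayed as ONE existential
binder per certified pair and `γ` (nothing is a `def … : Prop`, nothing is asserted for any curve):

* along `γ`, Example 3.10 special-fibre towers `T_X`, `T_Y` of `X`, `Y` (at `γ`-corresponding levels,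
  p. 47 (i)), with the `Π^temp`-actions on the underlying semi-graphs `𝔾^c_i` of their level fibres
  ((P2) of abc-iut-L3-t2's `SpecialFibreTower.PiData.actGraph`) and, for every cusp, the compatible system
  of open edges lying under the pro-cusp fixed by the representative decomposition group (the cusps of the
  coverings are the open edges of the `𝒢^c_i`, Ex. 3.10);
* the PRO-CUSP READING of the inertia groups: `I_x = D_x ∩ Δ^temp_X` is the stabiliser in `Δ^temp_X` of that
  system (p. 71: `D_x` is the decomposition group of the point; at the Galois level `N_i` the stabiliser of
  the level cusp is `I_x·N_i`, and `⋂_i I_x N_i = I_x` since `I_x ≅ Ẑ` is compact and the `N_i` are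
  exhaustive);
* Cor. 3.11 LEVELWISE, read on UNDERLYING SEMI-GRAPHS: isomorphisms `F_i : 𝔾^c[X_i] ⥲ 𝔾^c[Y_i]` that are
  `γ`-EQUIVARIANT («compatible … functorial with respect to `γ`»: `F ∘ inn(g) = inn(γ g) ∘ F`) and carry the
  pro-cusp of each cusp `x` of `X` to a `Π^temp_{Y_L}`-translate of the pro-cusp of a cusp `y` of `Y`
  (print's cusp matching, proof of Cor. 3.11 (ii)–(iv) p. 47).

From these, `h311` is GROUP THEORY (`TemperedCurve.map_inertia_subgroupOf_eq_of_proCuspData`, generic in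
the actions; `…_of_levelGraphIso`, at the tower's semi-graphs): `h ∈ γ(I_x)` iff `γ⁻¹ h` fixes the pro-cusp
of `x` iff (equivariance, `F_i` injective) `h` fixes its `F`-image iff `δ⁻¹ h δ` fixes the pro-cusp of `y` iff
`h ∈ δ I_y δ⁻¹`.  Origin level: `TemperedOrigin.inertiaLeaf_of_levelwiseCuspGraphIso` (G-L3d2g4-1 ⇐ the
binder) and `TemperedOrigin.cuspidalAbsolutenessHolds_of_levelwiseCuspGraphIso` (F-1704 ⇐ F-1708, the
`Δ̂`-law, the binder).  HONEST LIMITS: the binder is NOT derived here from the §3 carrier's `Cor311`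
(F-1721) per level — that junction needs the level special fibres as certified `SpecialFibreData` of the
covering curves and a law tying the action on OPEN edges to the cusp edge-like subgroups (abc-iut-w4-d083's
`CuspBranchesPreserved` currency); it is recorded on the GAP row, not attempted.  No tower-transport
hypothesis `γ(N^X_i) = N^Y_i` is USED by the proofs (it only locates the printed instantiation).  Nothing
here asserts anything for curves, asserts or refutes abc, or takes a side on [IUTchIII] Cor. 3.12;
typed ≠ proved.
-/

noncomputable section

namespace Literature.AnabelianGeometry.SemiGraphs

open CategoryTheory
open scoped Pointwise

/-! ### Generic bookkeeping -/

/-- Transport of `subgroupOf` along an isomorphism of the ambient subgroups: if membership in `I` and in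
`K` correspond under `γ` pointwise, then `γ` carries `I ∩ Δ_X` (as a subgroup of `Δ_X`) onto `K ∩ Δ_Y`.
[folklore] -/
private theorem map_subgroupOf_eq_of_forall_iff {GX GY : Type*} [Group GX] [Group GY]
    {ΔX : Subgroup GX} {ΔY : Subgroup GY} (γ : ΔX ≃* ΔY) {I : Subgroup GX} {K : Subgroup GY}
    (h : ∀ g : ΔX, (g : GX) ∈ I ↔ ((γ g : ΔY) : GY) ∈ K) :
    (I.subgroupOf ΔX).map γ.toMonoidHom = K.subgroupOf ΔY := by
  ext k
  constructor
  · rintro ⟨g, hg, rfl⟩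
    exact Subgroup.mem_subgroupOf.2 ((h g).1 (Subgroup.mem_subgroupOf.1 hg))
  · intro hk
    refine ⟨γ.symm k, ?_, γ.apply_symm_apply k⟩
    refine Subgroup.mem_subgroupOf.2 ((h (γ.symm k)).2 ?_)
    rw [γ.apply_symm_apply]
    exact Subgroup.mem_subgroupOf.1 hk

namespace TemperedCurve

variable {p : ℕ} [Fact p.Prime] (X Y : TemperedCurve p)

/-! ### The group theory of «(iii) follows from Corollary 3.11»: pro-cusp stabilisers transport -/

/-- **`γ(I_x) = δ I_y δ⁻¹` from a `γ`-equivariant matching of pro-cusps** — the group-theoretic core of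
«Assertion (iii) follows from Corollary 3.11» (p. 72 l. 14), GENERIC in the actions: `Π^temp_X` acts
(levelwise, `i : ι`) on sets `E^X_i`, `Π^temp_Y` on sets `E^Y_i`; the cuspidal geometric decomposition group
`I_x ⊆ Δ^temp_X` IS the stabiliser in `Δ^temp_X` of a system `c^X = (c^X_i)_i` (the pro-cusp of `x`), likewise
`I_y` for `c^Y`; and injections `F_i : E^X_i → E^Y_i` are `γ`-EQUIVARIANT and carry `c^X` to the
`δ`-translate of `c^Y` (`δ ∈ Π^temp_Y`).  Then `h ∈ γ(I_x) ⟺ γ⁻¹h` fixes `c^X ⟺ h` fixes `F c^X = δ c^Y ⟺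
δ⁻¹ h δ` fixes `c^Y ⟺ h ∈ δ I_y δ⁻¹`. [cite: MochizukiSemiAnbd2006, Thm 6.5(iii) p.72] -/
theorem map_inertia_subgroupOf_eq_of_proCuspData {ι : Type*} {EX EY : ι → Type*}
    (aX : ∀ i, X.PiTemp → EX i → EX i) (aY : ∀ i, Y.PiTemp → EY i → EY i)
    (haY_one : ∀ (i) (e : EY i), aY i 1 e = e)
    (haY_mul : ∀ (i) (g h : Y.PiTemp) (e : EY i), aY i (g * h) e = aY i g (aY i h e))
    (F : ∀ i, EX i → EY i) (hFinj : ∀ i, Function.Injective (F i))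
    (γ : X.DeltaTemp ≃ₜ* Y.DeltaTemp)
    (hF : ∀ (i) (g : X.DeltaTemp) (e : EX i),
      F i (aX i (g : X.PiTemp) e) = aY i ((γ g : Y.DeltaTemp) : Y.PiTemp) (F i e))
    {x : X.Pt} (cX : ∀ i, EX i)
    (hIX : ∀ g : X.DeltaTemp, (g : X.PiTemp) ∈ X.inertia x ↔ ∀ i, aX i (g : X.PiTemp) (cX i) = cX i)
    {y : Y.Pt} (cY : ∀ i, EY i)
    (hIY : ∀ h : Y.DeltaTemp, (h : Y.PiTemp) ∈ Y.inertia y ↔ ∀ i, aY i (h : Y.PiTemp) (cY i) = cY i)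
    (δ : Y.PiTemp) (hc : ∀ i, F i (cX i) = aY i δ (cY i)) :
    ((X.inertia x).subgroupOf X.DeltaTemp).map γ.toMulEquiv.toMonoidHom =
      (ConjAct.toConjAct δ • Y.inertia y).subgroupOf Y.DeltaTemp := by
  refine map_subgroupOf_eq_of_forall_iff γ.toMulEquiv fun g => ?_
  -- the conjugate `δ⁻¹ (γ g) δ` lies in `Δ^temp_Y`
  have hΔ : Y.DeltaTemp.Normal := MonoidHom.normal_ker _
  have hmem : δ⁻¹ * ((γ g : Y.DeltaTemp) : Y.PiTemp) * δ ∈ Y.DeltaTemp := by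
    have := hΔ.conj_mem _ (γ g).2 δ⁻¹
    simpa using this
  -- `aY δ⁻¹` undoes `aY δ`
  have hinv : ∀ (i) (e : EY i), aY i δ⁻¹ (aY i δ e) = e := fun i e => by
    rw [← haY_mul, inv_mul_cancel, haY_one]
  rw [hIX g, Subgroup.mem_pointwise_smul_iff_inv_smul_mem, ← ConjAct.toConjAct_inv,
    ConjAct.toConjAct_inv_smul]
  change _ ↔ ((⟨δ⁻¹ * ((γ g : Y.DeltaTemp) : Y.PiTemp) * δ, hmem⟩ : Y.DeltaTemp) : Y.PiTemp) ∈ Y.inertia y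
  rw [hIY]
  change (∀ i, aX i (g : X.PiTemp) (cX i) = cX i) ↔
    ∀ i, aY i (δ⁻¹ * ((γ g : Y.DeltaTemp) : Y.PiTemp) * δ) (cY i) = cY i
  refine forall_congr' fun i => ?_
  rw [← (hFinj i).eq_iff, hF, hc, haY_mul, haY_mul]
  constructor
  · intro h
    rw [h, hinv]
  · intro h
    have := congrArg (aY i δ) h
    rwa [← haY_mul, mul_inv_cancel, haY_one] at this

/-! ### At the tower's semi-graphs: actions by automorphisms of the level fibres `𝔾^c_i` -/

section LevelGraphs

variable {X Y}

/-- The action of `Π^temp` on the edges of a level fibre through `Π^temp →* Aut 𝔾^c_i` is unital.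
[cite: MochizukiSemiAnbd2006, Ex 3.10 p.44] -/
theorem autAct_edgeMap_one {G : Type*} [Group G] {𝔾 : SemiGraph.{0}} (A : G →* Aut 𝔾) (e : 𝔾.Edge) :
    (A 1).hom.edgeMap e = e := by
  rw [map_one]
  rfl

/-- … and multiplicative: `(g h) · e = g · (h · e)`. [cite: MochizukiSemiAnbd2006, Ex 3.10 p.44] -/
theorem autAct_edgeMap_mul {G : Type*} [Group G] {𝔾 : SemiGraph.{0}} (A : G →* Aut 𝔾) (g h : G)
    (e : 𝔾.Edge) : (A (g * h)).hom.edgeMap e = (A g).hom.edgeMap ((A h).hom.edgeMap e) := by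
  rw [map_mul, CategoryTheory.Aut.Aut_mul_def, Iso.trans_hom, SemiGraph.comp_edgeMap]
  rfl

/-- An isomorphism of semi-graphs is injective on edges. [cite: MochizukiSemiAnbd2006, §1 p.11] -/
theorem iso_edgeMap_injective {𝔾 𝔾' : SemiGraph.{0}} (F : 𝔾 ≅ 𝔾') : Function.Injective F.hom.edgeMap := by
  intro e₁ e₂ h
  have h' : (F.hom ≫ F.inv).edgeMap e₁ = (F.hom ≫ F.inv).edgeMap e₂ := by
    simp only [SemiGraph.comp_edgeMap, Function.comp_apply, h]
  rw [F.hom_inv_id, SemiGraph.id_edgeMap] at h'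
  simpa using h'

/-- **`γ(I_x) = δ I_y δ⁻¹` from a levelwise `γ`-equivariant isomorphism of the special-fibre semi-graphs
matching the pro-cusps** — `map_inertia_subgroupOf_eq_of_proCuspData` at the Example 3.10 towers: the
underlying semi-graphs `𝔾^c_i` of the level fibres of towers `T_X`, `T_Y` with their `Π^temp`-actions by
automorphisms ((P2) `actGraph`), the pro-cusp `c^X` of `x` / `c^Y` of `y` as systems of (open) edges whose
stabilisers in `Δ^temp` are `I_x` / `I_y`, and semi-graph isomorphisms `F_i : 𝔾^c[X_i] ⥲ 𝔾^c[Y_i]`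
(Cor. 3.11 at the corresponding levels, on underlying semi-graphs) that are `γ`-equivariant on edges and
carry `c^X` to `δ · c^Y`. [cite: MochizukiSemiAnbd2006, Thm 6.5(iii) p.72] -/
theorem map_inertia_subgroupOf_eq_of_levelGraphIso
    (TX : SpecialFibreTower X.DeltaTemp) (TY : SpecialFibreTower Y.DeltaTemp)
    (AX : ∀ i, X.PiTemp →* Aut (TX.Gc i).graph) (AY : ∀ i, Y.PiTemp →* Aut (TY.Gc i).graph)
    (FI : ∀ i, (TX.Gc i).graph ≅ (TY.Gc i).graph) (γ : X.DeltaTemp ≃ₜ* Y.DeltaTemp)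
    (hF : ∀ (i) (g : X.DeltaTemp) (e : (TX.Gc i).graph.Edge),
      (FI i).hom.edgeMap ((AX i (g : X.PiTemp)).hom.edgeMap e) =
        (AY i ((γ g : Y.DeltaTemp) : Y.PiTemp)).hom.edgeMap ((FI i).hom.edgeMap e))
    {x : X.Pt} (cX : ∀ i, (TX.Gc i).graph.Edge)
    (hIX : ∀ g : X.DeltaTemp, (g : X.PiTemp) ∈ X.inertia x ↔
      ∀ i, (AX i (g : X.PiTemp)).hom.edgeMap (cX i) = cX i)
    {y : Y.Pt} (cY : ∀ i, (TY.Gc i).graph.Edge)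
    (hIY : ∀ h : Y.DeltaTemp, (h : Y.PiTemp) ∈ Y.inertia y ↔
      ∀ i, (AY i (h : Y.PiTemp)).hom.edgeMap (cY i) = cY i)
    (δ : Y.PiTemp) (hc : ∀ i, (FI i).hom.edgeMap (cX i) = (AY i δ).hom.edgeMap (cY i)) :
    ((X.inertia x).subgroupOf X.DeltaTemp).map γ.toMulEquiv.toMonoidHom =
      (ConjAct.toConjAct δ • Y.inertia y).subgroupOf Y.DeltaTemp :=
  X.map_inertia_subgroupOf_eq_of_proCuspData Y (fun i g e => (AX i g).hom.edgeMap e)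
    (fun i g e => (AY i g).hom.edgeMap e) (fun i e => autAct_edgeMap_one (AY i) e)
    (fun i g h e => autAct_edgeMap_mul (AY i) g h e) (fun i => (FI i).hom.edgeMap)
    (fun i => iso_edgeMap_injective (FI i)) γ hF cX hIX cY hIY δ hc

end LevelGraphs

end TemperedCurve

/-! ### Origin level: the leaf G-L3d2g4-1 and the row F-1704 from the levelwise cusp–graph matching -/

namespace TemperedOrigin

variable {p : ℕ} [Fact p.Prime]

/-- **The Cor. 3.11 leaf of Thm. 6.5 (iii) (`h311`, GAP-LEDGER G-L3d2g4-1) from the levelwise cusp–graph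
matching along `γ`.**  The binder `hLG` displays, for every certified pair and every
`γ : Δ^temp_X ⥲ Δ^temp_Y`, the EXISTENCE of: Example 3.10 special-fibre towers `T_X`, `T_Y` (at
`γ`-corresponding levels, p. 47 (i)); the `Π^temp`-actions on the underlying semi-graphs of their level
fibres ((P2)); for every cusp the system of level open edges under its pro-cusp, with the PRO-CUSP READING
`I_x = Stab_{Δ^temp_X}` (§6 p. 71 with Ex. 3.10 p. 44); and Cor. 3.11's isomorphisms of the level
special fibres read on underlying semi-graphs, `γ`-equivariant («compatible … functorial with respect to
`γ`», pp. 45–46) and carrying pro-cusps of `X` to `Π^temp_{Y_L}`-translates of pro-cusps of `Y` (cusp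
matching, (ii)–(iv) p. 47).  CONCLUSION: verbatim the leaf `h311` of
`cuspidalAbsolutenessHolds_of_cor311_of_hatLaw`.  The binder is a hypothesis, asserted for no curve.
[cite: MochizukiSemiAnbd2006, Thm 6.5(iii) p.72] -/
theorem inertiaLeaf_of_levelwiseCuspGraphIso (Ω : TemperedOrigin p)
    (hLG : ∀ X Y : TemperedCurve p, Ω.IsHyperbolicCurveOrigin X → Ω.IsHyperbolicCurveOrigin Y →
      ∀ γ : X.DeltaTemp ≃ₜ* Y.DeltaTemp,
      ∃ (TX : SpecialFibreTower X.DeltaTemp) (TY : SpecialFibreTower Y.DeltaTemp)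
        (AX : ∀ i, X.PiTemp →* Aut (TX.Gc i).graph) (AY : ∀ i, Y.PiTemp →* Aut (TY.Gc i).graph)
        (cX : ∀ i, {x : X.Pt // X.IsCusp x} → (TX.Gc i).graph.Edge)
        (cY : ∀ i, {y : Y.Pt // Y.IsCusp y} → (TY.Gc i).graph.Edge)
        (FI : ∀ i, (TX.Gc i).graph ≅ (TY.Gc i).graph),
        (∀ (x : {x : X.Pt // X.IsCusp x}) (g : X.DeltaTemp), (g : X.PiTemp) ∈ X.inertia x.1 ↔
            ∀ i, (AX i (g : X.PiTemp)).hom.edgeMap (cX i x) = cX i x) ∧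
        (∀ (y : {y : Y.Pt // Y.IsCusp y}) (h : Y.DeltaTemp), (h : Y.PiTemp) ∈ Y.inertia y.1 ↔
            ∀ i, (AY i (h : Y.PiTemp)).hom.edgeMap (cY i y) = cY i y) ∧
        (∀ (i) (g : X.DeltaTemp) (e : (TX.Gc i).graph.Edge),
            (FI i).hom.edgeMap ((AX i (g : X.PiTemp)).hom.edgeMap e) =
              (AY i ((γ g : Y.DeltaTemp) : Y.PiTemp)).hom.edgeMap ((FI i).hom.edgeMap e)) ∧
        (∀ x : {x : X.Pt // X.IsCusp x}, ∃ (y : {y : Y.Pt // Y.IsCusp y}) (δ : Y.PiTemp),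
            ∀ i, (FI i).hom.edgeMap (cX i x) = (AY i δ).hom.edgeMap (cY i y))) :
    ∀ X Y : TemperedCurve p, Ω.IsHyperbolicCurveOrigin X → Ω.IsHyperbolicCurveOrigin Y →
      ∀ γ : X.DeltaTemp ≃ₜ* Y.DeltaTemp, ∀ x : X.Pt, X.IsCusp x →
        ∃ y : Y.Pt, Y.IsCusp y ∧ ∃ δ : ConjAct Y.PiTemp,
          ((X.inertia x).subgroupOf X.DeltaTemp).map γ.toMulEquiv.toMonoidHom =
            (δ • Y.inertia y).subgroupOf Y.DeltaTemp := by
  intro X Y hX hY γ x hx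
  obtain ⟨TX, TY, AX, AY, cX, cY, FI, hIX, hIY, hF, hc⟩ := hLG X Y hX hY γ
  obtain ⟨y, δ, hδ⟩ := hc ⟨x, hx⟩
  exact ⟨y.1, y.2, ConjAct.toConjAct δ,
    TemperedCurve.map_inertia_subgroupOf_eq_of_levelGraphIso TX TY AX AY FI γ hF (cX · ⟨x, hx⟩)
      (hIX ⟨x, hx⟩) (cY · y) (hIY y) δ hδ⟩

/-- **[SemiAnbd] Thm. 6.5 (iii) as printed (row F-1704 `CuspidalAbsolutenessHolds`) from F-1708, the
profinite `Δ̂`-law and the levelwise cusp–graph matching** — abc-iut-L3-d2's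
`cuspidalAbsolutenessHolds_of_cor311_of_hatLaw` with its Cor. 3.11 leaf `h311` (G-L3d2g4-1) SUPPLIED by
`inertiaLeaf_of_levelwiseCuspGraphIso`.  Residual of F-1704 along this path: F-1708 (`h65`, BY NAME), the
`Δ̂`-law (`hhat`, [AbsAnab] Lem. 1.3.8 type), and the binder `hLG` (Ex. 3.10 towers with pro-cusp systems
along `γ` + Cor. 3.11 levelwise on underlying semi-graphs). [cite: MochizukiSemiAnbd2006, Thm 6.5(iii) p.72] -/
theorem cuspidalAbsolutenessHolds_of_levelwiseCuspGraphIso (Ω : TemperedOrigin p)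
    (h65 : Ω.TemperedDecompositionGroupsHolds)
    (hhat : ∀ X Y : TemperedCurve p, Ω.IsHyperbolicCurveOrigin X → Ω.IsHyperbolicCurveOrigin Y →
      ∀ Φ : X.PiHat ≃ₜ* Y.PiHat, X.DeltaHat.map Φ.toMulEquiv.toMonoidHom = Y.DeltaHat)
    (hLG : ∀ X Y : TemperedCurve p, Ω.IsHyperbolicCurveOrigin X → Ω.IsHyperbolicCurveOrigin Y →
      ∀ γ : X.DeltaTemp ≃ₜ* Y.DeltaTemp,
      ∃ (TX : SpecialFibreTower X.DeltaTemp) (TY : SpecialFibreTower Y.DeltaTemp)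
        (AX : ∀ i, X.PiTemp →* Aut (TX.Gc i).graph) (AY : ∀ i, Y.PiTemp →* Aut (TY.Gc i).graph)
        (cX : ∀ i, {x : X.Pt // X.IsCusp x} → (TX.Gc i).graph.Edge)
        (cY : ∀ i, {y : Y.Pt // Y.IsCusp y} → (TY.Gc i).graph.Edge)
        (FI : ∀ i, (TX.Gc i).graph ≅ (TY.Gc i).graph),
        (∀ (x : {x : X.Pt // X.IsCusp x}) (g : X.DeltaTemp), (g : X.PiTemp) ∈ X.inertia x.1 ↔
            ∀ i, (AX i (g : X.PiTemp)).hom.edgeMap (cX i x) = cX i x) ∧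
        (∀ (y : {y : Y.Pt // Y.IsCusp y}) (h : Y.DeltaTemp), (h : Y.PiTemp) ∈ Y.inertia y.1 ↔
            ∀ i, (AY i (h : Y.PiTemp)).hom.edgeMap (cY i y) = cY i y) ∧
        (∀ (i) (g : X.DeltaTemp) (e : (TX.Gc i).graph.Edge),
            (FI i).hom.edgeMap ((AX i (g : X.PiTemp)).hom.edgeMap e) =
              (AY i ((γ g : Y.DeltaTemp) : Y.PiTemp)).hom.edgeMap ((FI i).hom.edgeMap e)) ∧
        (∀ x : {x : X.Pt // X.IsCusp x}, ∃ (y : {y : Y.Pt // Y.IsCusp y}) (δ : Y.PiTemp),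
            ∀ i, (FI i).hom.edgeMap (cX i x) = (AY i δ).hom.edgeMap (cY i y))) :
    Ω.CuspidalAbsolutenessHolds :=
  Ω.cuspidalAbsolutenessHolds_of_cor311_of_hatLaw h65 hhat (Ω.inertiaLeaf_of_levelwiseCuspGraphIso hLG)

end TemperedOrigin

end Literature.AnabelianGeometry.SemiGraphs

end
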